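import Literature.NumberTheory.LFunctions.WeilMarkovQuadratic
import Literature.NumberTheory.LFunctions.WeilArchimedeanMoments
import HarnessLib

/-!
# Cutoff invariance: frequencies outside the window are invisible to `|ĝ|²` (`stub_cutoffInvariance`)

Route `SpectralTrace`, crux `WindowStep` (stmt-RiemannHypothesis-14659), line `Sketch`
(skeleton `Summit.RiemannHypothesis.RiemannHypothesis.Cruxes.WindowStep.Sketch`), stub
`stub_cutoffInvariance`.

**Statement.** For a Weil test function `g` with `tsupport g ⊆ [-a, a]` and every real `x` with
`2a ≤ |x|`,
`∫ ‖ĝ(1/2 + it)‖² cos(t x) dt = 0`,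
where `ĝ = weilMellin g`. In the density form of Weil's quadratic functional the prime power `m`
enters through `Λ(m) m^{-1/2} ∫ ‖ĝ(1/2 + it)‖² cos(t log m) dt`; the lemma says that the prime
powers with `log m ≥ 2a` (outside the window) contribute nothing, so the prime cutoff may be
realigned freely beyond `2a`.

**Proof.** Let `k = g ⋆ g̃ = weilConv g (weilReflect g)`, a Weil test function
(`IsWeilTest.weilConv`, `IsWeilTest.weilReflect`) with `k̂(1/2 + it) = ‖ĝ(1/2 + it)‖²`
(`weilMellin_weilConv_weilReflect_half`) and `k(x) = 0` for `2a ≤ |x|`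
(`weilConv_weilReflect_eq_zero_of_le_abs`). Mellin (= Fourier) inversion on the critical line
(`weilMellin_inversion` at `c = 1/2`) gives
`∫ ‖ĝ(1/2 + it)‖² e^{-itx} dt = 2π k(x) = 0`; the integrand is integrable
(`integrable_norm_sq_weilMellin_half_line`), so taking real parts
(`Re(‖ĝ‖² e^{-itx}) = ‖ĝ‖² cos(tx)`) gives the claim. [folklore]
-/

set_option linter.dupNamespace false

noncomputable section

open Complex MeasureTheory Set
open scoped Real

namespace Summit.RiemannHypothesis.RiemannHypothesis.Theorems.SpectralTraceWindowStep

open Literature.NumberTheory.LFunctions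

/-- Mellin inversion for the autocorrelation `k = g ⋆ g̃` on the critical line:
`∫ ‖ĝ(1/2 + iy)‖² e^{-iyx} dy = 2π k(x)` (`weilMellin_inversion` at `c = 1/2` together with
`k̂(1/2 + iy) = ‖ĝ(1/2 + iy)‖²`). [folklore] -/
theorem stub_cutoffInvariance_inversion {g : ℝ → ℂ} (hg : IsWeilTest g) (x : ℝ) :
    ∫ y : ℝ, ((‖weilMellin g (1 / 2 + y * I)‖ ^ 2 : ℝ) : ℂ) * cexp (-(y * I) * x) =
      2 * π * weilConv g (weilReflect g) x := by
  have h := weilMellin_inversion (hg.weilConv hg.weilReflect) (1 / 2) x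
  have e2 : cexp ((((1 / 2 : ℝ) : ℂ) - 1 / 2) * (x : ℂ)) = 1 := by
    rw [show (((1 / 2 : ℝ) : ℂ) - 1 / 2) = 0 by push_cast; ring, zero_mul, Complex.exp_zero]
  rw [e2, mul_one] at h
  have e : ∀ y : ℝ, weilMellin (weilConv g (weilReflect g)) (((1 / 2 : ℝ) : ℂ) + y * I) =
      ((‖weilMellin g (1 / 2 + y * I)‖ ^ 2 : ℝ) : ℂ) := fun y ↦ by
    rw [show (((1 / 2 : ℝ)) : ℂ) = 1 / 2 by push_cast; ring]
    exact weilMellin_weilConv_weilReflect_half hg y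
  simp_rw [e] at h
  exact h

/-- The integrand `‖ĝ(1/2 + iy)‖² e^{-iyx}` of the inversion formula is integrable (its norm is
`‖ĝ(1/2 + iy)‖²`, integrable by `integrable_norm_sq_weilMellin_half_line`). [folklore] -/
theorem stub_cutoffInvariance_integrable {g : ℝ → ℂ} (hg : IsWeilTest g) (x : ℝ) :
    Integrable fun y : ℝ ↦ ((‖weilMellin g (1 / 2 + y * I)‖ ^ 2 : ℝ) : ℂ) * cexp (-(y * I) * x) := by
  refine (integrable_norm_sq_weilMellin_half_line hg).mono' ?_ (Filter.Eventually.of_forall fun y ↦ ?_)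
  · exact ((Complex.continuous_ofReal.comp (continuous_norm_sq_weilMellin_half_line hg)).mul
      (by fun_prop)).aestronglyMeasurable
  · rw [norm_mul, show -((y : ℂ) * I) * (x : ℂ) = ((-(y * x) : ℝ) : ℂ) * I by push_cast; ring,
      Complex.norm_exp_ofReal_mul_I, mul_one, Complex.norm_real,
      Real.norm_of_nonneg (by positivity)]

/-- The real integrand `‖ĝ(1/2 + iy)‖² cos(yx)` is the real part of `‖ĝ(1/2 + iy)‖² e^{-iyx}`.
[folklore] -/
theorem stub_cutoffInvariance_re (g : ℝ → ℂ) (x y : ℝ) :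
    ‖weilMellin g (1 / 2 + y * I)‖ ^ 2 * Real.cos (y * x) =
      (((‖weilMellin g (1 / 2 + y * I)‖ ^ 2 : ℝ) : ℂ) * cexp (-(y * I) * x)).re := by
  rw [Complex.re_ofReal_mul, show -((y : ℂ) * I) * (x : ℂ) = ((-(y * x) : ℝ) : ℂ) * I by
    push_cast; ring, Complex.exp_ofReal_mul_I_re, Real.cos_neg]

/-- **Cutoff invariance (`stub_cutoffInvariance`).** For a Weil test function `g` supported in
`[-a, a]` and `2a ≤ |x|`, `∫ ‖ĝ(1/2 + it)‖² cos(t x) dt = 0`: the integral is the real part of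
`∫ ‖ĝ(1/2 + it)‖² e^{-itx} dt = 2π (g ⋆ g̃)(x)`, and `g ⋆ g̃` vanishes at `|x| ≥ 2a`
(`weilConv_weilReflect_eq_zero_of_le_abs`). [folklore] -/
theorem stub_cutoffInvariance :
    ∀ (g : ℝ → ℂ) (a x : ℝ), Literature.NumberTheory.LFunctions.IsWeilTest g → tsupport g ⊆ Set.Icc (-a) a →
      2 * a ≤ |x| →
        ∫ t : ℝ, ‖Literature.NumberTheory.LFunctions.weilMellin g (1 / 2 + t * Complex.I)‖ ^ 2 * Real.cos (t * x) = 0 := by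
  intro g a x hg hsupp hx
  have hC := stub_cutoffInvariance_inversion hg x
  rw [weilConv_weilReflect_eq_zero_of_le_abs hg hsupp hx, mul_zero] at hC
  have hF : (fun t : ℝ ↦ ‖weilMellin g (1 / 2 + t * I)‖ ^ 2 * Real.cos (t * x)) =
      fun t : ℝ ↦ (((‖weilMellin g (1 / 2 + t * I)‖ ^ 2 : ℝ) : ℂ) * cexp (-(t * I) * x)).re :=
    funext (stub_cutoffInvariance_re g x)
  have hre := integral_re (stub_cutoffInvariance_integrable hg x)
  simp only [RCLike.re_to_complex] at hre
  rw [hF, hre, hC, Complex.zero_re]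

end Summit.RiemannHypothesis.RiemannHypothesis.Theorems.SpectralTraceWindowStep
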